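import Literature.AlgebraicGeometry.Motives.MotivatedCyclesCupLeProofs
import HarnessLib

/-!
# Motivated classes are stable under pull-back (André 1996, Prop. 2.1 (ii), p. 15): the discharge

Y. André, *Pour une théorie inconditionnelle des motifs*, Publ. Math. IHÉS 83 (1996), §2.1,
Proposition 2.1 (ii) (p. 14), first inclusion: «`pr_X^* A_mot(X)_E ⊆ A_mot(X × Z)_E`», and the
`f^*` formalism (p. 15, after the Corollaire): «On obtient le formalisme `f_*, f^*` (pour un
morphisme `f`) en composant les correspondances motivées avec la classe du graphe de `f` ou sa
transposée», the proof of (ii) resting on Lemme 1.3.2 («sur chaque composante connexe …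
rationnellement proportionnel à `pr_{X*}(pr^* α ∪ (⋆(β ⊗ ⋆[Z])))`, et l'on conclut par le même
lemme»).

This file proves `theorem motivatedClasses_map_pullback_le_holds : W.motivatedClasses_map_pullback_le`,
the discharge of the named fact `WeilCohomology.motivatedClasses_map_pullback_le` of
`Motives/MotivatedCycles.lean` (stated there, since 2026-08-15, under `W.HasHardLefschetz` and
`W.HasProdHyperplaneClasses`), for the tree's relational generators `W.IsMotivatedClass`; it is
the sibling of `Motives/MotivatedCyclesCupLeProofs.lean` (Prop. 2.1 (i)) and uses the same three
ingredients:

1. **The transposed graph** (C-lite axiom `exists_isInducedBy_pullback`): `f^* : H•(Y) → H•(X)` is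
   induced by a rational algebraic class `Γ ∈ Aᵐ(Y × X)_ℚ`; transposing to `X × Y`
   (`trace_cup_transposeClass`), `tr_X (f^* y ∪ w) = tr_{X×Y} ((pr_X^* w ∪ ᵗΓ) ∪ pr_Y^* y)`.
2. **Base change** (`trace_pullbackGraph_eq`, by Künneth induction on `ᵗΓ`, axiom (B)): for a
   generator `y = pr_{Y*} u` (`u = α ∪ ⋆β` on `Y × Z`) this equals
   `tr_{X×(Y×Z)} ((pr_X^* w ∪ p^* ᵗΓ) ∪ pr_{YZ}^* u)`, `p : X × (Y × Z) → X × Y` the projection; i.e.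
   `f^* y = pr_{X*} (p^* ᵗΓ ∪ pr_{YZ}^* u)` (Poincaré duality, `isPerfPair_cupPairing`).
3. **Lemme 1.3.2** (`star_externalCup_star_mem_span`): `pr_{YZ}^*(⋆β) = 1_X ⊠ ⋆β = ⋆_X(η_Xⁿ) ⊠ ⋆β`
   (Kleiman's normalisation `⋆_X Lⁿ 1 = 1`, `isLefschetzStar_apply_pow`, for a hyperplane class `η_X`
   of `X`) is a `K`-combination of classes `⋆((η_Xⁿ ⊠ β) ∪ (η_Xᶜ ⊠ ηᵍ)) ∪ (η_Xᵃ ⊠ ηᵇ)` for the Lefschetz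
   involution `⋆` (`starOp`) of the product polarisation `pr₁^* η_X + pr₂^* η` of `X × (Y × Z)` — a
   hyperplane class by `W.HasProdHyperplaneClasses`; hence `p^* ᵗΓ ∪ pr_{YZ}^* u` is a combination of
   classes `A ∪ ⋆B` with `A`, `B` rational algebraic, whose push-forwards to `X` are generators
   (`isMotivatedClass_pushforward_cup_star`, auxiliary variety `Y × Z`).

When `dim X = 0` there is no hyperplane class to normalise with; there `H⁰(X) = K · 1_X` (the
trace `H⁰(X) → K` is bijective, axiom (A)) lies in `A⁰(X)_K ⊆ A_mot⁰(X)`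
(`one_mem_ratAlgebraicClasses`, `algebraicClasses_le_motivatedClasses_holds`), and higher degrees
vanish. Everything is a theorem: no definitions, no named facts (net debt −1).

## References

* Y. André, *Pour une théorie inconditionnelle des motifs*, Publ. Math. IHÉS 83 (1996) 5–49:
  §1.3 Lemme 1.3.2 (p. 13), §2.1 Prop. 2.1 (ii) (p. 14), its proof and the `f^*, f_*` formalism
  (p. 15); Thm. 0.3 (ii). [Andre1996Motifs]
* S. Kleiman, *Algebraic cycles and the Weil conjectures* (1968), §1.2 (A), (B), (C), §1.3
  (the transposed graph induces `f^*`), 1.4.2 (`⋆`). [Kleiman1968]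
-/

universe u v

open CategoryTheory AlgebraicGeometry MonoidalCategory CartesianMonoidalCategory
open scoped TensorProduct

noncomputable section

namespace Literature.AlgebraicGeometry.Motives

namespace WeilCohomology

variable {k : Type u} [Field k] {K : Type v} [Field K] [CharZero K] (W : WeilCohomology k K)

/-! ## Degree bookkeeping -/

section Congr

variable {P Q V : SchemeOver k}

/-- Retyping the total degree of an external product inside a cup product (the two sides differ
only in the proofs of the degree identities). [folklore] -/
private theorem cup_externalCup_degree_congr {e i j d d' l : ℕ} (h : i + j = d) (h' : i + j = d')
    (H : e + d = l) (H' : e + d' = l) (s : W.obj (P ⊗ Q) e) (a : W.obj P i) (b : W.obj Q j) :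
    W.cup H s (W.externalCup P Q h a b) = W.cup H' s (W.externalCup P Q h' a b) := by
  subst h h'
  rfl

/-- Retyping the total degrees of two external products inside a cup product. [folklore] -/
private theorem cup_externalCup_externalCup_degree_congr {i j d d' i' j' e e' l : ℕ}
    (h₁ : i + j = d) (h₁' : i + j = d') (h₂ : i' + j' = e) (h₂' : i' + j' = e') (H : d + e = l)
    (H' : d' + e' = l) (a : W.obj P i) (b : W.obj Q j) (a' : W.obj P i') (b' : W.obj Q j') :
    W.cup H (W.externalCup P Q h₁ a b) (W.externalCup P Q h₂ a' b') =
      W.cup H' (W.externalCup P Q h₁' a b) (W.externalCup P Q h₂' a' b') := by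
  subst h₁ h₁' h₂ h₂'
  rfl

/-- The graded-commutative reshuffle `D ∪ (E ∪ (S ∪ M)) = ((D ∪ E) ∪ M) ∪ S` when `S` or `M` has
even degree (`cup_comm` without sign, `cup_assoc`). [folklore] -/
private theorem cup_cup_cup_reshuffle {N₀ : ℕ} (hV : IsSmoothProjective N₀ V)
    {iD iE iS iM dSM dESM dDE dDEM N : ℕ} (he : Even iS ∨ Even iM)
    (hSM : iS + iM = dSM) (hESM : iE + dSM = dESM) (hN : iD + dESM = N)
    (hDE : iD + iE = dDE) (hDEM : dDE + iM = dDEM) (hN' : dDEM + iS = N)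
    (D : W.obj V iD) (E : W.obj V iE) (S : W.obj V iS) (M : W.obj V iM) :
    W.cup hN D (W.cup hESM E (W.cup hSM S M)) = W.cup hN' (W.cup hDEM (W.cup hDE D E) M) S := by
  have hMS : iM + iS = dSM := by omega
  have hEM : iE + iM = iE + iM := rfl
  have h₁ : iE + iM + iS = dESM := by omega
  have h₂ : iD + (iE + iM) = dDEM := by omega
  rw [W.cup_comm_of_even hV hSM hMS he S M, ← W.cup_assoc hV hEM hMS h₁ hESM E M S,
    ← W.cup_assoc hV h₂ h₁ hN' hN D (W.cup hEM E M) S, ← W.cup_assoc hV hDE hEM hDEM h₂ D E M]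

end Congr

/-! ## Base change: `pr_Y^* pr_{Y*} u` against the transposed graph -/

section BaseChange

variable {n m l : ℕ} {X Y Z : SchemeOver k}

/-- **Base change of a push-forward along `pr_Y : Y × Z → Y` to `X × Y`, paired with a class `E`
on `X × Y`** (the cohomological content of `pr_X^* ∘ pr_{Y*} = pr_{XY*} ∘ pr_{YZ}^*` on
`X × Y × Z`): if `y ∈ H^{2p}(Y)` satisfies the projection formula
`tr_Y (y ∪ w) = tr_{Y×Z} (u ∪ pr_Y^* w)` against `u` on `Y × Z`, `p : X × (Y × Z) → X × Y` is the
projection and `w ∈ H^{2q''}(X)`, `p + q'' = dim X`, then for EVERY class `E ∈ H^{2m}(X × Y)`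
`tr_{X×(Y×Z)} ((pr_X^* w ∪ p^* E) ∪ pr_{YZ}^* u) = tr_{X×Y} ((pr_X^* w ∪ E) ∪ pr_Y^* y)`.
Both sides are additive in `E`; for `E = g ⊠ h` (`kunneth_induction`) they are
`tr_X (w ∪ g) · tr_{Y×Z} (pr_Y^* h ∪ u) = tr_X (w ∪ g) · tr_Y (h ∪ y)` in the surviving bidegree
`|g| = 2p` (`trace_cup_cup_externalCup_of_eq`) and vanish otherwise. [cite: Andre1996Motifs, §2.1 proof of Prop. 2.1 (ii) (p. 15)] -/
theorem trace_pullbackGraph_eq (hX : IsSmoothProjective n X) (hY : IsSmoothProjective m Y)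
    (hZ : IsSmoothProjective l Z) (π : X ⊗ (Y ⊗ Z) ⟶ X ⊗ Y)
    (hπ₁ : π ≫ fst X Y = fst X (Y ⊗ Z)) (hπ₂ : π ≫ snd X Y = snd X (Y ⊗ Z) ≫ fst Y Z)
    {p q'' : ℕ} (hn : p + q'' = n) (u : W.obj (Y ⊗ Z) (2 * (p + l))) (y : W.obj Y (2 * p))
    (hy : ∀ (q : ℕ) (hq : p + q = m) (w : W.obj Y (2 * q)),
      W.cupPairing Y m (2 * p) (2 * q) (by omega) y w =
        W.trace (Y ⊗ Z) (m + l) (W.cup (show 2 * (p + l) + 2 * q = 2 * (m + l) by omega) u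
          (W.pullback (fst Y Z) (2 * q) w)))
    (w : W.obj X (2 * q'')) (H₂ : 2 * q'' + 2 * m + 2 * (p + l) = 2 * (n + (m + l)))
    (G₁ : 2 * q'' + 2 * m + 2 * p = 2 * (n + m)) (E : W.obj (X ⊗ Y) (2 * m)) :
    W.trace (X ⊗ (Y ⊗ Z)) (n + (m + l))
        (W.cup H₂ (W.cup rfl (W.pullback (fst X (Y ⊗ Z)) (2 * q'') w) (W.pullback π (2 * m) E))
          (W.pullback (snd X (Y ⊗ Z)) (2 * (p + l)) u)) =
      W.trace (X ⊗ Y) (n + m)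
        (W.cup G₁ (W.cup rfl (W.pullback (fst X Y) (2 * q'') w) E)
          (W.pullback (snd X Y) (2 * p) y)) := by
  have hXY := IsSmoothProjective.tensor_holds hX hY
  have hYZ := IsSmoothProjective.tensor_holds hY hZ
  have hXW := IsSmoothProjective.tensor_holds hX hYZ
  induction E using W.kunneth_induction hX hY with
  | zero => simp
  | add e e' he he' => simp only [map_add, LinearMap.add_apply, he, he']
  | ext i j hij g h =>
    -- `p^*(g ⊠ h) = g ⊠ pr_Y^* h`
    rw [W.pullback_externalCup hXW hXY π hij g h, hπ₁, hπ₂, W.pullback_comp, LinearMap.comp_apply,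
      ← W.externalCup_apply]
    by_cases hi : i = 2 * p
    · -- the surviving bidegree `|g| = 2p`, `|h| = 2q`, `p + q = dim Y`
      subst hi
      obtain ⟨q, rfl⟩ : ∃ q, j = 2 * q := ⟨m - p, by omega⟩
      have h₁ : 2 * q'' + 2 * p = 2 * n := by omega
      have h₂ : 2 * q + 2 * (p + l) = 2 * (m + l) := by omega
      have h₂' : 2 * (p + l) + 2 * q = 2 * (m + l) := by omega
      have h₃ : 2 * q + 2 * p = 2 * m := by omega
      have h₃' : 2 * p + 2 * q = 2 * m := by omega
      have hyw := hy q (by omega) h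
      rw [W.cupPairing_apply] at hyw
      rw [W.trace_cup_cup_externalCup_of_eq hX hYZ hij H₂ h₁ h₂,
        W.trace_cup_cup_externalCup_of_eq hX hY hij G₁ h₁ h₃,
        W.cup_comm_of_even hYZ h₂ h₂' (Or.inl ⟨q, by ring⟩), ← hyw,
        W.cup_comm_of_even hY h₃' h₃ (Or.inl ⟨p, by ring⟩)]
    · -- off the surviving bidegree both sides vanish
      rw [W.trace_cup_cup_externalCup_of_ne hX hYZ hij H₂ (by omega),
        W.trace_cup_cup_externalCup_of_ne hX hY hij G₁ (by omega)]

end BaseChange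

/-! ## Assembly: Prop. 2.1 (ii), pull-backs -/

section Assembly

variable {n m : ℕ} {X Y : SchemeOver k}

/-- **The pull-back of a motivated generator is motivated** (André 1996, Prop. 2.1 (ii) first
inclusion and the `f^*` formalism, p. 15), for the relational generators `W.IsMotivatedClass`: if
`y ∈ H^{2p}(Y)` is a motivated class (auxiliary data `(Z, η, ⋆, α, β)`, `u = α ∪ ⋆β` on `Y × Z`)
and `f : X → Y`, then `f^* y ∈ A_mot^p(X)`. With `Γ ∈ Aᵐ(Y × X)_ℚ` inducing `f^*`
(`exists_isInducedBy_pullback`) and `p : X × (Y × Z) → X × Y` the projection,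
`f^* y = pr_{X*}(p^* ᵗΓ ∪ pr_{YZ}^* u)` (`trace_pullbackGraph_eq` and Poincaré duality), and
`pr_{YZ}^* u = pr_{YZ}^* α ∪ (⋆_X(η_Xⁿ) ⊠ ⋆β)`, which Lemme 1.3.2 (`star_externalCup_star_mem_span`,
for the involution `starOp` of the product polarisation of `X × (Y × Z)`, a hyperplane class by
`W.HasProdHyperplaneClasses`) rewrites as a `K`-combination of `A ∪ ⋆B`, `A`, `B` rational
algebraic; their push-forwards are generators (`isMotivatedClass_pushforward_cup_star`). For
`dim X = 0`, `H⁰(X) = K · 1_X ⊆ A⁰(X) ⊆ A_mot⁰(X)`; above the top degree `f^* y = 0`.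
[cite: Andre1996Motifs, §2.1 Prop. 2.1 (ii) (p. 14) and p. 15 (f^* via the graph of f)] -/
theorem pullback_mem_motivatedClasses_of_isMotivatedClass (hL : W.HasHardLefschetz)
    (hPH : W.HasProdHyperplaneClasses) (hX : IsSmoothProjective n X) (hY : IsSmoothProjective m Y)
    (f : X ⟶ Y) {p : ℕ} {y : W.obj Y (2 * p)} (hy : W.IsMotivatedClass m Y p y) :
    W.pullback f (2 * p) y ∈ W.motivatedClasses n X p := by
  -- above the top degree there is nothing to prove
  by_cases hpn : n < p
  · rw [W.eq_zero_of_lt hX (i := 2 * p) (by omega) (W.pullback f (2 * p) y)]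
    exact zero_mem _
  -- `dim X = 0`: `H⁰(X) = K · 1_X ⊆ A⁰(X)_K ⊆ A_mot⁰(X)` (the trace `H⁰(X) → K` is bijective)
  by_cases hn0 : n = 0
  · subst hn0
    obtain rfl : p = 0 := by omega
    have htr := W.bijective_trace hX
    have h1 : W.trace X 0 (W.one X) ≠ 0 := by
      intro h0
      obtain ⟨e, he⟩ := htr.2 1
      have hone : W.one X = 0 := htr.1 (by rw [h0, map_zero])
      rw [← W.one_cup hX (zero_add _) e, hone, LinearMap.map_zero₂, map_zero] at he
      exact zero_ne_one he
    have hv : W.pullback f (2 * 0) y =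
        (W.trace X 0 (W.pullback f (2 * 0) y) / W.trace X 0 (W.one X)) • W.one X :=
      htr.1 (by rw [map_smul, smul_eq_mul, div_mul_cancel₀ _ h1])
    rw [hv]
    exact Submodule.smul_mem _ _ (W.algebraicClasses_le_motivatedClasses_holds hL hX 0
      (W.ratAlgebraicClasses_le_algebraicClasses X 0 (W.one_mem_ratAlgebraicClasses hX)))
  obtain ⟨q'', hn⟩ : ∃ q'', p + q'' = n := ⟨n - p, by omega⟩
  obtain ⟨ηX, hηX⟩ := W.isHyperplaneClass_nonempty hX (by omega)
  -- the data of the generator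
  obtain ⟨l, Z, hZ, η, hη, S, hS, a, b, b', hbb', hab, α, β, hα, hβ, hrel⟩ := hy
  have hXY := IsSmoothProjective.tensor_holds hX hY
  have hYX := IsSmoothProjective.tensor_holds hY hX
  have hYZ := IsSmoothProjective.tensor_holds hY hZ
  have hXW := IsSmoothProjective.tensor_holds hX hYZ
  -- the product polarisation of `X × (Y × Z)` (a hyperplane class) and the two involutions
  have hΗ : W.IsHyperplaneClass (X ⊗ (Y ⊗ Z)) (W.prodPolarisation X (Y ⊗ Z) ηX η) :=
    hPH hX hYZ hηX hη
  have hSX := W.isLefschetzStar_starOp hL hX hηX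
  have hS₀ := W.isLefschetzStar_starOp hL hXW hΗ
  -- the transposed graph and the projection `p : X × (Y × Z) → X × Y`
  obtain ⟨Γ, hΓalg, hΓ⟩ := W.exists_isInducedBy_pullback hX hY f
  obtain ⟨π, hπ₁, hπ₂⟩ : ∃ π : X ⊗ (Y ⊗ Z) ⟶ X ⊗ Y,
      π ≫ fst X Y = fst X (Y ⊗ Z) ∧ π ≫ snd X Y = snd X (Y ⊗ Z) ≫ fst Y Z :=
    ⟨lift (fst _ _) (snd _ _ ≫ fst Y Z), lift_fst _ _, lift_snd _ _⟩
  -- degrees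
  have hu : 2 * a + 2 * b' = 2 * (p + l) := by omega
  have H₂ : 2 * m + 2 * (p + l) = 2 * (p + (m + l)) := by omega
  have he : 2 * (p + (m + l)) + 2 * q'' = 2 * (n + (m + l)) := by omega
  have hd : 2 * p + 2 * q'' = 2 * n := by omega
  have h0 : 2 * 0 + 2 * b' = 2 * b' := by omega
  -- `pr_{YZ}^*(⋆β) = ⋆_X(η_Xⁿ) ⊠ ⋆β` (`⋆_X(η_Xⁿ) = 1_X`), hence `pr_{YZ}^* u = pr_{YZ}^* α ∪ (⋆_X(η_Xⁿ) ⊠ ⋆β)`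
  have hX₁ : W.externalCup X (Y ⊗ Z) h0 (W.starOp hL hX hηX (2 * n) (2 * 0) (W.pow X ηX n))
      (S (2 * b) (2 * b') β) = W.pullback (snd X (Y ⊗ Z)) (2 * b') (S (2 * b) (2 * b') β) := by
    rw [W.externalCup_apply, W.isLefschetzStar_apply_pow hX hSX, W.map_one hXW hX, W.one_cup hXW]
  have hsndu : W.pullback (snd X (Y ⊗ Z)) (2 * (p + l)) (W.cup hu α (S (2 * b) (2 * b') β)) =
      W.cup hu (W.pullback (snd X (Y ⊗ Z)) (2 * a) α) (W.externalCup X (Y ⊗ Z) h0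
        (W.starOp hL hX hηX (2 * n) (2 * 0) (W.pow X ηX n)) (S (2 * b) (2 * b') β)) := by
    rw [W.map_cup hXW hYZ (snd X (Y ⊗ Z)) hu, hX₁]
  -- rational algebraicity of `p^* ᵗΓ ∪ pr^* α`, of `η_Xⁿ ⊠ β` and of the exterior monomials
  have hΓt : W.transposeClass Γ ∈ W.ratAlgebraicClasses (X ⊗ Y) m := by
    rw [W.transposeClass_apply]
    exact W.pullback_mem_ratAlgebraicClasses hXY hYX _ hΓalg
  have hDE : W.cup (show 2 * m + 2 * a = 2 * (m + a) by omega)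
      (W.pullback π (2 * m) (W.transposeClass Γ)) (W.pullback (snd X (Y ⊗ Z)) (2 * a) α) ∈
      W.ratAlgebraicClasses (X ⊗ (Y ⊗ Z)) (m + a) :=
    W.cup_mem_ratAlgebraicClasses hXW rfl _ _ (W.pullback_mem_ratAlgebraicClasses hXW hXY π hΓt)
      (W.pullback_mem_ratAlgebraicClasses hXW hYZ _ hα)
  have hηX₁ := W.mem_ratAlgebraicClasses_of_isHyperplaneClass hX hηX
  have hη₁ := W.mem_ratAlgebraicClasses_of_isHyperplaneClass hYZ hη
  have hpowβ : W.externalCup X (Y ⊗ Z) (show 2 * n + 2 * b = 2 * (n + b) by omega)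
      (W.pow X ηX n) β ∈ W.ratAlgebraicClasses (X ⊗ (Y ⊗ Z)) (n + b) := by
    rw [W.externalCup_apply]
    exact W.cup_mem_ratAlgebraicClasses hXW rfl _ _
      (W.pullback_mem_ratAlgebraicClasses hXW hX _ (W.pow_mem_ratAlgebraicClasses hX hηX₁ n))
      (W.pullback_mem_ratAlgebraicClasses hXW hYZ _ hβ)
  have hmono : ∀ (i j : ℕ) (h : 2 * i + 2 * j = 2 * (i + j)),
      W.externalCup X (Y ⊗ Z) h (W.pow X ηX i) (W.pow (Y ⊗ Z) η j) ∈
        W.ratAlgebraicClasses (X ⊗ (Y ⊗ Z)) (i + j) := fun i j h ↦ by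
    rw [W.externalCup_apply]
    exact W.cup_mem_ratAlgebraicClasses hXW rfl _ _
      (W.pullback_mem_ratAlgebraicClasses hXW hX _ (W.pow_mem_ratAlgebraicClasses hX hηX₁ i))
      (W.pullback_mem_ratAlgebraicClasses hXW hYZ _ (W.pow_mem_ratAlgebraicClasses hYZ hη₁ j))
  -- `pr_{X*}(p^* ᵗΓ ∪ (pr^* α ∪ w))` is motivated for every `w` in the span of Lemme 1.3.2
  have hT : ∀ w ∈ Submodule.span K {z' : W.obj (X ⊗ (Y ⊗ Z)) (2 * b') |
      ∃ (a₁ b₁ c₁ g₁ M M' : ℕ) (hM : 2 * n + 2 * b + (2 * c₁ + 2 * g₁) = M)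
        (hT' : M' + (2 * a₁ + 2 * b₁) = 2 * b'),
        z' = W.cup hT' (W.starOp hL hXW hΗ M M' (W.cup hM
              (W.externalCup X (Y ⊗ Z) rfl (W.pow X ηX n) β)
              (W.externalCup X (Y ⊗ Z) rfl (W.pow X ηX c₁) (W.pow (Y ⊗ Z) η g₁))))
            (W.externalCup X (Y ⊗ Z) rfl (W.pow X ηX a₁) (W.pow (Y ⊗ Z) η b₁))},
      W.pushforward (N := n + (m + l)) hX (fst X (Y ⊗ Z)) he hd
        (W.cup H₂ (W.pullback π (2 * m) (W.transposeClass Γ))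
          (W.cup hu (W.pullback (snd X (Y ⊗ Z)) (2 * a) α) w)) ∈
        W.motivatedClasses n X p := by
    intro w hw
    induction hw using Submodule.span_induction with
    | zero =>
      simp only [map_zero]
      exact zero_mem _
    | add w w' _ _ hw hw' =>
      simp only [map_add]
      exact add_mem hw hw'
    | smul c₀ w _ hw =>
      simp only [map_smul]
      exact Submodule.smul_mem _ c₀ hw
    | mem w hw =>
      obtain ⟨a₁, b₁, c₁, g₁, M, M', hM, hT', rfl⟩ := hw
      -- off total degree `2 dim (X × (Y × Z))` the star operator vanishes
      by_cases hMM : M + M' = 2 * (n + (m + l))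
      swap
      · rw [hS₀.1 M M' hMM, LinearMap.zero_apply, LinearMap.map_zero₂]
        simp only [map_zero]
        exact zero_mem _
      obtain ⟨b₀, rfl⟩ : ∃ b₀, M = 2 * b₀ := ⟨n + b + (c₁ + g₁), by omega⟩
      obtain ⟨b₀', rfl⟩ : ∃ b₀', M' = 2 * b₀' := ⟨n + (m + l) - b₀, by omega⟩
      -- retype the inner classes with even total degrees
      have hM' : 2 * (n + b) + 2 * (c₁ + g₁) = 2 * b₀ := by omega
      have hT'' : 2 * b₀' + 2 * (a₁ + b₁) = 2 * b' := by omega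
      rw [W.cup_externalCup_externalCup_degree_congr rfl
          (show 2 * n + 2 * b = 2 * (n + b) by omega) rfl
          (show 2 * c₁ + 2 * g₁ = 2 * (c₁ + g₁) by omega) hM hM',
        W.cup_externalCup_degree_congr rfl (show 2 * a₁ + 2 * b₁ = 2 * (a₁ + b₁) by omega)
          hT' hT'',
        -- `p^*ᵗΓ ∪ (pr^*α ∪ (⋆B ∪ mono)) = ((p^*ᵗΓ ∪ pr^*α) ∪ mono) ∪ ⋆B`
        W.cup_cup_cup_reshuffle hXW (Or.inl ⟨b₀', by ring⟩) hT'' hu H₂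
          (show 2 * m + 2 * a = 2 * (m + a) by omega)
          (show 2 * (m + a) + 2 * (a₁ + b₁) = 2 * (m + a + (a₁ + b₁)) by omega)
          (show 2 * (m + a + (a₁ + b₁)) + 2 * b₀' = 2 * (p + (m + l)) by omega)]
      refine (W.isMotivatedClass_pushforward_cup_star hX hYZ hΗ hS₀
        (a := m + a + (a₁ + b₁)) (b := b₀) (b' := b₀') (p₀ := p) (q₀ := q'')
        (by omega) (by omega) (by omega) ?_ ?_ he hd).mem_motivatedClasses
      · exact W.cup_mem_ratAlgebraicClasses hXW rfl _ _ hDE (hmono a₁ b₁ _)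
      · exact W.cup_mem_ratAlgebraicClasses hXW (show n + b + (c₁ + g₁) = b₀ by omega) _ _ hpowβ
          (hmono c₁ g₁ _)
  -- `f^* y = pr_{X*}(p^* ᵗΓ ∪ pr_{YZ}^* u)` by Poincaré duality
  have Hm : 2 * q'' + 2 * m + 2 * (p + l) = 2 * (n + (m + l)) := by omega
  have heq : W.pullback f (2 * p) y = W.pushforward (N := n + (m + l)) hX (fst X (Y ⊗ Z)) he hd
      (W.cup H₂ (W.pullback π (2 * m) (W.transposeClass Γ))
        (W.cup hu (W.pullback (snd X (Y ⊗ Z)) (2 * a) α) (W.externalCup X (Y ⊗ Z) h0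
          (W.starOp hL hX hηX (2 * n) (2 * 0) (W.pow X ηX n)) (S (2 * b) (2 * b') β)))) := by
    haveI := W.isPerfPair_cupPairing hX (2 * p) (2 * q'') hd
    refine (LinearMap.IsPerfPair.bijective_left (W.cupPairing X n (2 * p) (2 * q'') hd)).1 ?_
    ext w
    -- the right-hand side: adjunction, then reassociation
    have he' : 2 * q'' + 2 * (p + (m + l)) = 2 * (n + (m + l)) := by omega
    rw [W.cupPairing_apply, W.cupPairing_apply, W.trace_cup_pushforward, ← hsndu,
      W.cup_comm_of_even hXW he he' (Or.inr ⟨q'', by ring⟩), ← W.cup_assoc hXW rfl H₂ Hm he',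
      W.trace_pullbackGraph_eq hX hY hZ π hπ₁ hπ₂ hn (W.cup hu α (S (2 * b) (2 * b') β)) y hrel w
        Hm (by omega)]
    -- the left-hand side: the transposed graph
    have Hm₁ : 2 * p + 2 * m + 2 * q'' = 2 * (n + m) := by omega
    have Hm₂ : 2 * q'' + (2 * p + 2 * m) = 2 * (n + m) := by omega
    have h' : 2 * m + 2 * p = 2 * p + 2 * m := by omega
    rw [hΓ (2 * p) (2 * q'') hd y w, ← W.trace_cup_transposeClass hY hX _ Hm₁,
      W.transposeClass_apply (W.cup _ _ Γ), W.transposeClass_apply (W.pullback _ _ w),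
      W.map_cup hXY hYX (β_ X Y).hom rfl, ← LinearMap.comp_apply (W.pullback (β_ X Y).hom (2 * p)),
      ← W.pullback_comp, braiding_hom_fst,
      ← LinearMap.comp_apply (W.pullback (β_ X Y).hom (2 * q'')), ← W.pullback_comp,
      braiding_hom_snd, ← W.transposeClass_apply,
      W.cup_comm_of_even hXY Hm₁ Hm₂ (Or.inr ⟨q'', by ring⟩),
      W.cup_comm_of_even hXY rfl h' (Or.inl ⟨p, by ring⟩), ← W.cup_assoc hXY rfl h' _ Hm₂]
  rw [heq]
  exact hT _ (W.star_externalCup_star_mem_span hL hPH hX hYZ hηX hη hSX hS hS₀ h0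
    (W.pow X ηX n) β)

/-- **Discharge of the named fact `WeilCohomology.motivatedClasses_map_pullback_le`** (André 1996,
§2.1, Prop. 2.1 (ii) first inclusion `pr_X^* A_mot(X)_E ⊆ A_mot(X × Z)_E` and the `f^*` formalism
of p. 15; Thm. 0.3 (ii)): for a Weil cohomology theory with the hard Lefschetz property and
product hyperplane classes and `f : X → Y` a morphism of smooth projective varieties, `f^*` maps
`A_mot^p(Y)` into `A_mot^p(X)`. By linearity of `f^*` it suffices to treat the generators,
`pullback_mem_motivatedClasses_of_isMotivatedClass`. [cite: Andre1996Motifs, §2.1 Prop. 2.1 (ii) (p. 14) and p. 15 (f^* via the graph of f); Thm. 0.3 (ii)] -/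
theorem motivatedClasses_map_pullback_le_holds : W.motivatedClasses_map_pullback_le := by
  intro hL hPH n m X Y hX hY f p
  refine Submodule.map_le_iff_le_comap.mpr (Submodule.span_le.mpr fun y hy ↦ ?_)
  exact W.pullback_mem_motivatedClasses_of_isMotivatedClass hL hPH hX hY f hy

end Assembly

end WeilCohomology

end Literature.AlgebraicGeometry.Motives

end
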